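import Summits.BirchSwinnertonDyer.BirchSwinnertonDyer.Theorems.LeadingTermPinchPrimePinchAtOfOpenStubs
import Summits.BirchSwinnertonDyer.BirchSwinnertonDyer.Theorems.LeadingTermPinchPrimeSemisimpleInfinitelyOftenOfSchneider
import Summits.BirchSwinnertonDyer.BirchSwinnertonDyer.Theorems.LeadingTermPinchPrimeSemisimpleIffSchneiderInfinitelyOften
import Summits.BirchSwinnertonDyer.BirchSwinnertonDyer.Theorems.LeadingTermPinchPrimeSchneiderOfHasCMRankLeOne
import Literature.NumberTheory.EllipticCurves.LeadingTerm
import Literature.NumberTheory.EllipticCurves.BertrandCMHeightNonvanishing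
import Literature.NumberTheory.EllipticCurves.MordellWeilTheoremProofs
import Literature.NumberTheory.EllipticCurves.PAdicHeightsRegulatorProofs

/-!
# BirchSwinnertonDyer / LeadingTerm — crux `PinchPrime` (stmt-BirchSwinnertonDyer-16218),
# line `SketchIdeator2`, stub `stub_pinchPrime_of_openRanges` (G9, GLUE: the crux from the open
# stubs RESTRICTED TO THEIR OPEN RANGES)

Registered stub (G9) of the lead skeleton `Cruxes/PinchPrime/Lines/SketchIdeator2.lean` (v14). The
crux `LeadingTerm.PinchPrime` asks, for every elliptic `E/ℚ` (globally minimal `W`), for ONE good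
ordinary prime `p ≥ 5`, a canonical `p`-adic height datum and a newform `f` of `E` with
`ord_{T=0} L_p(f, α_p, T) = rank_ℤ E(ℚ)`. The line reduces it to two OPEN stubs — (A) cofinite
finiteness of `Ш(E/ℚ)[p^∞]` over the good ordinary primes, (B) semisimplicity of `T` at `0` on
`ℚ_p ⊗ X(E/ℚ_∞)` at infinitely many good ordinary `p ≥ 5` — and three named facts; two known
slices are landed (G6 `L(E,1) ≠ 0`, p135014; G7 + G8 analytic rank `≤ 1`, p135950 + p136200).
This file records the RESIDUAL CONTENT of the line, kernel-checked: modulo six theorem-grade named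
facts taken as hypotheses —
* `Schneider1985_order_charGenerator` (Perrin-Riou–Schneider; Balakrishnan–Müller–Stein, Math.
  Comp. 85 (2016), Thm. 1.7),
* `Greenberg1999_coinvariantsRank_eq_selmerCorank_rat` (Greenberg, LNM 1716 (1999), Thm. 1.2),
* `exists_isNewformOf` (modularity, Breuil–Conrad–Diamond–Taylor 2001),
* `burungale_castella_skinner_charIdeal_eq_padicLFunction` (Burungale–Castella–Skinner 2025,
  Thm. 1.1.2 (a)),
* `rank_eq_analyticRank_of_analyticRank_le_one` (Gross–Zagier–Kolyvagin; Darmon, CBMS 101 (2004),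
  Thm. 3.22),
* `bertrand_pairing_self_ne_zero_of_hasCM` (Bertrand, LNM 1068 (1984), §3 Corollaire 1) —
the crux follows from (A) asked ONLY for curves of analytic rank `≥ 2` and (B) asked ONLY for
curves of analytic rank `≥ 2` and for non-CM curves of analytic rank `1`.

Proof. Feed the landed bridge `stub_pinchAt_of_openStubs` (G5, p134807: facts ∧ A ∧ B ⟹ the
`W`-instance of the crux) curve by curve. For (A): in analytic rank `≤ 1` GZK gives `Ш(E/ℚ)`
finite, so `B = ∅` works; otherwise the hypothesis. For (B): in analytic rank `≥ 2` and in the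
non-CM rank-`1` case the hypothesis; otherwise GZK gives `rank_ℤ E(ℚ) = r_an ≤ 1` and `Ш` finite,
Schneider's conjecture holds at every good ordinary `p ≥ 5` — trivially in rank `0`
(`schneider_of_mordellWeilRank_eq_zero`: `Reg_p = det ∅ = 1`, Mazur–Tate–Teitelbaum 1986, §II.4)
and by Bertrand's theorem for CM curves of rank `1` (landed G8
`stub_schneider_of_hasCM_of_rank_le_one`, p136200) — and the landed G3
`stub_semisimpleInfinitelyOftenOfSchneider` (p134480) converts "Schneider at every good ordinary
`p ≥ 5` ∧ (A)" into (B).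
-/

noncomputable section

set_option linter.dupNamespace false

namespace Summit.BirchSwinnertonDyer.BirchSwinnertonDyer.Cruxes.PinchPrime.FirstLayerStability

open scoped MatrixGroups ModularForm
open CongruenceSubgroup Literature.NumberTheory.EllipticCurves
  Literature.NumberTheory.EllipticCurves.ModularForms
open Summit.BirchSwinnertonDyer.BirchSwinnertonDyer.Theses

/-- **In Mordell–Weil rank `0`, Schneider's conjecture holds for every height datum**: a
Mordell–Weil basis is indexed by `Fin 0` (`exists_isMordellWeilBasis_holds`), the regulator does not
depend on the basis (`IsMordellWeilBasis.padicRegulatorOf_eq_padicRegulator`), and the determinant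
of the empty Gram matrix is `1` (cf. `padicRegulator_eq_one_of_finite`).
[cite: MazurTateTeitelbaum1986Invent, §II.4] -/
theorem schneider_of_mordellWeilRank_eq_zero (W : WeierstrassCurve ℚ) [W.IsElliptic] (p : ℕ)
    [Fact p.Prime] (h0 : W.mordellWeilRank = 0) (Dh : WeierstrassCurve.PAdicHeightData W p) :
    WeierstrassCurve.SchneiderConjecture Dh := by
  obtain ⟨P, hP⟩ := W.exists_isMordellWeilBasis_holds
  unfold WeierstrassCurve.SchneiderConjecture
  rw [← hP.padicRegulatorOf_eq_padicRegulator Dh, WeierstrassCurve.padicRegulatorOf]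
  haveI : IsEmpty (Fin W.mordellWeilRank) := by
    rw [h0]
    infer_instance
  -- (`convert`: the `DecidableEq (Fin r)` instance inside `padicRegulatorOf` is the classical one)
  refine ne_of_eq_of_ne ?_ one_ne_zero
  convert Matrix.det_isEmpty (A := Dh.pairingMatrix P)

/-- **The crux from the six facts and the two open stubs restricted to their open ranges**
(stub G9 of crux `PinchPrime`, line `SketchIdeator2`): modulo PRS, control, modularity, BCS,
Gross–Zagier–Kolyvagin and Bertrand (hypotheses), if (A) `Ш(E/ℚ)[p^∞]` is finite for all but
finitely many good ordinary `p` for every curve of analytic rank `≥ 2`, and (B) `T` is semisimple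
at `0` on `ℚ_p ⊗ X(E/ℚ_∞)` at infinitely many good ordinary `p ≥ 5` (normalised cyclotomic datum)
for every curve of analytic rank `≥ 2` and every non-CM curve of analytic rank `1`, then every
`W` satisfies its instance of the crux (the `∃ p`-body of `LeadingTerm.PinchPrime`, stated verbatim).
[cite: Darmon2004, Thm. 3.22] [cite: Bertrand1984ThetaCM, §3 Corollaire 1]
[cite: GreenbergLNM1716, §1 Conj. 1.12] -/
theorem stub_pinchPrime_of_openRanges :
    Schneider1985_order_charGenerator → Greenberg1999_coinvariantsRank_eq_selmerCorank_rat →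
    exists_isNewformOf → burungale_castella_skinner_charIdeal_eq_padicLFunction →
    rank_eq_analyticRank_of_analyticRank_le_one → bertrand_pairing_self_ne_zero_of_hasCM →
    (∀ (W : WeierstrassCurve ℚ) [W.IsElliptic] [W.IsGloballyMinimal], 2 ≤ W.analyticRank →
      ∃ B : Finset ℕ, ∀ p ∉ B, ∀ [Fact p.Prime], IsOrdinaryAt W p →
        Finite (AddCommGroup.primaryComponent W.sha p)) →
    (∀ (W : WeierstrassCurve ℚ) [W.IsElliptic] [W.IsGloballyMinimal],
      (2 ≤ W.analyticRank ∨ (W.analyticRank = 1 ∧ ¬ W.HasCM)) → ∀ B : Finset ℕ,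
        ∃ p ∉ B, ∃ _ : Fact p.Prime, 5 ≤ p ∧ IsOrdinaryAt W p ∧
          ∃ (κ : ZpExtension ℚ p) (γ : Field.absoluteGaloisGroup ℚ),
            κ.IsCyclotomic ∧ κ.IsTopGenerator γ ∧ IsCyclotomicVariable p γ ∧
            ∀ D : W.SelmerDualData κ γ,
              LinearMap.ker (IwasawaAlgebra.mulTRat p D.X ∘ₗ IwasawaAlgebra.mulTRat p D.X)
                = LinearMap.ker (IwasawaAlgebra.mulTRat p D.X)) →
    ∀ (W : WeierstrassCurve ℚ) [W.IsElliptic] [W.IsGloballyMinimal],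
      ∃ (p : ℕ) (_ : Fact p.Prime), 5 ≤ p ∧ IsOrdinaryAt W p ∧
        ∃ (D : WeierstrassCurve.PAdicHeightData W p), D.IsCanonical ∧
          ∃ (N : ℕ) (_ : NeZero N) (f : CuspForm (Gamma0 N) 2), IsNewformOf W f ∧
            (padicLFunction f (unitRoot W p : ℚ_[p])).order = W.mordellWeilRank := by
  intro hPRS hcontrol hmod hBCS hGZK hBer hA2 hB2 W _ _
  refine stub_pinchAt_of_openStubs hmod hBCS hcontrol (fun W _ _ ↦ ?_) (fun W _ _ B ↦ ?_) W
  · -- (A) for `W`: GZK in analytic rank `≤ 1`, the hypothesis otherwise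
    by_cases h : W.analyticRank ≤ 1
    · haveI : Finite W.sha := (hGZK W h).2
      exact ⟨∅, fun p _ _ _ ↦ inferInstance⟩
    · exact hA2 W (by omega)
  · -- (B) for `W` outside `B`
    by_cases h2 : 2 ≤ W.analyticRank
    · exact hB2 W (Or.inl h2) B
    have h1 : W.analyticRank ≤ 1 := by omega
    have hrk : W.mordellWeilRank = W.analyticRank := (hGZK W h1).1
    have hAfin : ∃ B : Finset ℕ, ∀ p ∉ B, ∀ [Fact p.Prime], IsOrdinaryAt W p →
        Finite (AddCommGroup.primaryComponent W.sha p) := by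
      haveI : Finite W.sha := (hGZK W h1).2
      exact ⟨∅, fun p _ _ _ ↦ inferInstance⟩
    by_cases hCM : W.HasCM
    · -- CM, rank ≤ 1: Bertrand (G8) + G3
      have hle : W.mordellWeilRank ≤ 1 := by omega
      exact stub_semisimpleInfinitelyOftenOfSchneider hPRS hcontrol hmod hBCS W
        (fun p _ h5 hord Dh hDh ↦
          stub_schneider_of_hasCM_of_rank_le_one hBer W hCM hle p h5 hord Dh hDh) hAfin B
    · by_cases h0 : W.analyticRank = 0
      · -- rank 0: Schneider trivial + G3
        have hr0 : W.mordellWeilRank = 0 := by omega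
        exact stub_semisimpleInfinitelyOftenOfSchneider hPRS hcontrol hmod hBCS W
          (fun p _ _ _ Dh _ ↦ schneider_of_mordellWeilRank_eq_zero W p hr0 Dh) hAfin B
      · -- non-CM, analytic rank 1: the hypothesis
        exact hB2 W (Or.inr ⟨by omega, hCM⟩) B

/-- **The residual content in classical form** (stub G10 `stub_pinchAt_of_openRanges_schneider`;
corollary of `stub_pinchPrime_of_openRanges` and the
landed classical reading G4 `stub_semisimpleInfinitelyOften_iff_schneiderInfinitelyOften`, p134659):
modulo the same six named facts (hypotheses), the crux at every `W` follows from
(A) cofinite finiteness of `Ш(E/ℚ)[p^∞]` for the curves of analytic rank `≥ 2`, and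
(S) NON-DEGENERACY OF THE CANONICAL CYCLOTOMIC `p`-ADIC HEIGHT (`Reg_p(E, Dh) ≠ 0` for every
canonical datum, i.e. Schneider's conjecture at `p`) AT INFINITELY MANY GOOD ORDINARY `p ≥ 5` for
the curves of analytic rank `≥ 2` and the non-CM curves of analytic rank `1` — the `∃^∞ p`
weakening of Mazur–Stein–Tate 2006, Conj. 1.1, asked exactly on the range where it is open in
print. (In analytic rank `1` the `Ш`-hypothesis needed by G4 is supplied by GZK.)
[cite: MazurSteinTate2006, Conj. 1.1] [cite: Darmon2004, Thm. 3.22]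
[cite: Bertrand1984ThetaCM, §3 Corollaire 1] -/
theorem stub_pinchAt_of_openRanges_schneider :
    Schneider1985_order_charGenerator → Greenberg1999_coinvariantsRank_eq_selmerCorank_rat →
    exists_isNewformOf → burungale_castella_skinner_charIdeal_eq_padicLFunction →
    rank_eq_analyticRank_of_analyticRank_le_one → bertrand_pairing_self_ne_zero_of_hasCM →
    (∀ (W : WeierstrassCurve ℚ) [W.IsElliptic] [W.IsGloballyMinimal], 2 ≤ W.analyticRank →
      ∃ B : Finset ℕ, ∀ p ∉ B, ∀ [Fact p.Prime], IsOrdinaryAt W p →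
        Finite (AddCommGroup.primaryComponent W.sha p)) →
    (∀ (W : WeierstrassCurve ℚ) [W.IsElliptic] [W.IsGloballyMinimal],
      (2 ≤ W.analyticRank ∨ (W.analyticRank = 1 ∧ ¬ W.HasCM)) → ∀ B : Finset ℕ,
        ∃ p ∉ B, ∃ _ : Fact p.Prime, 5 ≤ p ∧ IsOrdinaryAt W p ∧
          ∀ Dh : WeierstrassCurve.PAdicHeightData W p, Dh.IsCanonical →
            WeierstrassCurve.SchneiderConjecture Dh) →
    ∀ (W : WeierstrassCurve ℚ) [W.IsElliptic] [W.IsGloballyMinimal],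
      ∃ (p : ℕ) (_ : Fact p.Prime), 5 ≤ p ∧ IsOrdinaryAt W p ∧
        ∃ (D : WeierstrassCurve.PAdicHeightData W p), D.IsCanonical ∧
          ∃ (N : ℕ) (_ : NeZero N) (f : CuspForm (Gamma0 N) 2), IsNewformOf W f ∧
            (padicLFunction f (unitRoot W p : ℚ_[p])).order = W.mordellWeilRank := by
  intro hPRS hcontrol hmod hBCS hGZK hBer hA2 hS2 W _ _
  refine stub_pinchPrime_of_openRanges hPRS hcontrol hmod hBCS hGZK hBer hA2 (fun W _ _ hr B ↦ ?_) W
  have hA : ∃ B : Finset ℕ, ∀ p ∉ B, ∀ [Fact p.Prime], IsOrdinaryAt W p →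
      Finite (AddCommGroup.primaryComponent W.sha p) := by
    rcases hr with h2 | ⟨h1, -⟩
    · exact hA2 W h2
    · haveI : Finite W.sha := (hGZK W (by omega)).2
      exact ⟨∅, fun p _ _ _ ↦ inferInstance⟩
  exact (stub_semisimpleInfinitelyOften_iff_schneiderInfinitelyOften hPRS hcontrol hmod hBCS W
    hA).mpr (hS2 W hr) B

end Summit.BirchSwinnertonDyer.BirchSwinnertonDyer.Cruxes.PinchPrime.FirstLayerStability

end
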